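import Mathlib
import HarnessLib
import Summits.Langlands.Langlands.Theses.ParityBlindBianchi
import Summits.Langlands.Langlands.Theses.RuelleTorsionArtinWeight
import Summits.Langlands.Langlands.Theorems.ParityBlindBianchiArtinWeightRealisationLevelSolvableSector
import Summits.Langlands.Langlands.Theorems.ParityBlindBianchiArtinWeightRealisationLevelStubIsOddDualTransport
import Summits.Langlands.Langlands.Theorems.ParityBlindBianchiArtinWeightRealisationLevelStubBcAscent
import Summits.Langlands.Langlands.Theorems.ParityBlindBianchiArtinWeightRealisationLevelStubInertNonTwistWitness
import Literature.NumberTheory.Automorphic.OddArtinWeightOne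
import Literature.NumberTheory.Automorphic.BaseChangeCyclicCuspidal
import Literature.NumberTheory.Automorphic.GLnAdelicStructureProofs
import Literature.NumberTheory.Automorphic.PiOfArtinRepOfTwistedHeckeTheoryGL2Proofs

/-!
# The odd base-change sector of R′ = `ParityBlindBianchi.ArtinWeightRealisationLevel`
(stmt-Langlands-15111) — helper file (`--supports`), line `Sketch`, continuation lead c14

The crux R′ (and the shared crux R = `RuelleTorsionArtinWeight.ArtinWeightRealisation`, item
stmt-Langlands-11057, to which it is equivalent modulo the twisted Hecke theory of `GL(2)`,
p108329/p121004) asks that a `p`-adically automorphic irreducible finite-image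
`σ : Γ_K → GL₂(ℚ̄_p)`, `K` imaginary quadratic, be Satake–Frobenius compatible with a cuspidal `π`
of `GL₂(𝔸_K)` at every good place.  The SOLVABLE sector needs no `p`-adic input
(`…SolvableSector`, p104572: Langlands–Tunnell + Gelbart's Prop. 4.1).  This file closes, again
without the `p`-adic hypothesis, the ODD BASE-CHANGE sector: the `σ` that are restrictions
`ρ|_{Γ_K}` of an ODD finite-image `ρ : Γ_ℚ → GL₂(ℚ̄_p)` (equivalently — conjugating `ρ` — that are
`GL₂(ℚ̄_p)`-conjugate to such a restriction), modulo theorems in print that the tree already names: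

* Khare–Wintenberger 2009, Thm. 10.1 (ii): Artin's conjecture for odd irreducible `ρ : Γ_ℚ →
  GL₂(ℂ)` (`khareWintenberger_artinConjecture_of_isOdd`, `Automorphic/OddArtinWeightOne`) and
  Booker 2003, Corollary: Artin ⟹ strong Artin over `ℚ` (`booker_strongArtin_of_artinConjecture`);
  together: odd strong Artin over `ℚ` in Tunnell's a.e. form (`strongArtin_ae_of_isOdd`, proved);
* Arthur–Clozel 1989, Ch. 3, Thm. 4.2 (a): the weak base-change lift of a cuspidal `π` not fixed by
  the quadratic twist is CUSPIDAL (`baseChange_cyclic_cuspidal`, `Automorphic/BaseChangeCyclicCuspidal`);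
* Jacquet–Langlands 1970, Thm. 11.1 / Cor. 11.2: the twisted Hecke theory of `GL(2)`
  (`JacquetLanglands1970_twistedHeckeTheoryGL2`), which yields Gelbart 1997 Prop. 4.1
  (`frobSatakeCompatibleAt_of_isPiOfArtinRep_of_isUnramifiedAt_of_JacquetLanglands1970_twistedHeckeTheoryGL2`);
* Chebotarev's density theorem for Artin representations — PROVED in the tree
  (`chebotarev_artinRep_holds`), used through the landed stub `stub_inertNonTwistWitness`.

Mechanism (`satakeFrobCompatibleAt_restrictField_of_isOdd`): contragredient transport
`τ = ι ∘ ρ^∨ : Γ_ℚ → GL₂(ℂ)` (odd: `stub_isOddDualTransport`, p122835; irreducible because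
`τ|_{Γ_K}` is the transport of `ρ|_{Γ_K}`, `isIrreducible_of_dual_transport`); `π_ℚ := π(τ)` (odd
strong Artin); a non-twist witness at an inert place (`stub_inertNonTwistWitness`: Burnside —
`stub_existsTraceNeZero`, p122891 — and Chebotarev for `τ ⊕ χ_K`); the CUSPIDAL weak lift
`Π = BC_K(π_ℚ)` (Arthur–Clozel); `Π = π(τ|_{Γ_K})` a.e. (`stub_bcAscent`, p122990); the pointwise
dictionary `satakeFrobCompatibleAt_iff_of_dual_transport` and the landed rigidity
`satakeFrobCompatibleAt_of_eventually_of_isUnramifiedAt` (Gelbart 4.1) upgrade a.e. compatibility to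
EVERY place where `ρ|_{Γ_K}` is unramified.

* `finite_range_restrictField`, `isIrreducible_of_isIrreducible_restrictField` — bookkeeping;
* `eventually_satakeFrobCompatibleAt_restrictField_of_isOdd` — the sector in the a.e. shape of the
  shared crux R, displayed hypotheses (odd strong Artin over `ℚ`, `baseChange_cyclic_cuspidal`) — no
  Hecke theory of `GL(2)` at all;
* `satakeFrobCompatibleAt_restrictField_of_isOdd` — the sector at EVERY unramified place (shape of
  R′), displayed hypotheses (the same + Gelbart 4.1 σ-shadow), via the landed rigidity;
* `satakeFrobCompatibleAt_restrictField_of_isOdd_of_facts` — the same from the four NAMED facts;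
* `artinWeightRealisationLevel_oddBaseChange_sector` — R′ verbatim on the sector (the `p`-adic
  automorphy package is used only through `IsHeckeAssociatedAt.isUnramifiedAt`);
* `artinWeightRealisationLevel_of_residual_sector` — modulo the five named facts (Langlands–Tunnell,
  KW, Booker, Arthur–Clozel 4.2 (a), JL) the crux follows from its restriction to the σ with
  INSOLUBLE projective image that are NOT restrictions of an odd finite-image representation of
  `Γ_ℚ` — which is exactly where the route `ParityBlindBianchi` consumes R′ (`σ = ρ|_{Γ_K}`, `ρ`
  EVEN icosahedral; cf. `Literature.Barriers.Langlands.NonRegularWeightBarrier` and Calegari 2023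
  §12: the even icosahedral case of Artin's conjecture is open).

* `artinWeightRealisation_oddBaseChange_sector`, `artinWeightRealisation_of_residual_sector` — the
  same two statements for the SHARED crux R (item stmt-Langlands-11057; a.e. conclusion), modulo KW,
  Booker, Arthur–Clozel (+ Langlands–Tunnell for the residue) and NO Hecke theory.

All registered as stubs on stmt-Langlands-15111.  No definitions, no new named facts.
-/

noncomputable section

open scoped BigOperators Topology Classical Matrix NumberField MatrixGroups
open Literature.NumberTheory.Automorphic Literature.NumberTheory.GaloisRepresentations
  IsDedekindDomain NumberField Filter

-- `Summit.Langlands.Langlands.…`: summit = sub-problem name (D-0017 nested layout), not a typo.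
set_option linter.dupNamespace false

namespace Summit.Langlands.Langlands.Theorems.ArtinWeightRealisationLevel


section Lemmas

/-- The image of a restriction `ρ|_{Γ_K}` is contained in the image of `ρ`; in particular it is
finite when the image of `ρ` is. [folklore] -/
theorem finite_range_restrictField {p : ℕ} [Fact p.Prime] (K : Type) [Field K] [NumberField K]
    (ρ : FramedGaloisRep ℚ (PadicAlgCl p) 2) (h : Finite ρ.toMonoidHom.range) :
    Finite (ρ.restrictField K).toMonoidHom.range := by
  apply Set.Finite.to_subtype
  apply Set.Finite.subset (Set.toFinite (ρ.toMonoidHom.range : Set (GL (Fin 2) (PadicAlgCl p))))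
  rintro _ ⟨g, rfl⟩
  exact ⟨absGaloisRestrict ℚ K g, rfl⟩

/-- **Irreducibility ascends from a restriction**: if `τ|_{Γ_K}` is irreducible then so is `τ`
(a `Γ_ℚ`-stable subspace is `Γ_K`-stable; `Representation.IsIrreducible.of_comp`). [folklore] -/
theorem isIrreducible_of_isIrreducible_restrictField (K : Type) [Field K] [NumberField K]
    (τ : FramedArtinRep ℚ 2) (h : (τ.restrictField K).toGaloisRep.IsIrreducible) :
    τ.toGaloisRep.IsIrreducible :=
  Representation.IsIrreducible.of_comp _ (absGaloisRestrict ℚ K).toMonoidHom h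

end Lemmas

/-- **The odd base-change sector, almost-everywhere form (displayed hypotheses; no Hecke theory).**
Assume odd strong Artin over `ℚ` in Tunnell's a.e. form (`hSA`; in the tree `strongArtin_ae_of_isOdd`
from Khare–Wintenberger's Artin conjecture for odd `ρ` + Booker 2003) and the cuspidality of
prime-degree cyclic base change (`hBC : baseChange_cyclic_cuspidal`, Arthur–Clozel 1989 Ch. 3
Thm. 4.2 (a)).  Let `K` be a quadratic field, `p` a prime, `ι : ℚ̄_p ≃+* ℂ`, and
`ρ : Γ_ℚ → GL₂(ℚ̄_p)` continuous with finite image, ODD, with `ρ|_{Γ_K}` irreducible.  Then some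
cuspidal `π` of `GL₂(𝔸_K)` is Satake–Frobenius compatible with `ρ|_{Γ_K}` at ALMOST EVERY place of
`K` (the conclusion shape of the shared crux R).  Proof: contragredient transport
`τ = ι ∘ ρ^∨ : Γ_ℚ → GL₂(ℂ)` (odd: `stub_isOddDualTransport`; irreducible since `τ|_{Γ_K}` is the
transport of `ρ|_{Γ_K}`), `π_ℚ := π(τ)` (`hSA`), a non-twist witness at an inert place
(`stub_inertNonTwistWitness`: Burnside + Chebotarev for `τ ⊕ χ_K`), the CUSPIDAL weak base-change
lift `Π = BC_K(π_ℚ)` (`hBC`), `Π = π(τ|_{Γ_K})` a.e. (`stub_bcAscent`) and the pointwise dictionary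
`satakeFrobCompatibleAt_iff_of_dual_transport`. [folklore] -/
theorem eventually_satakeFrobCompatibleAt_restrictField_of_isOdd : (∀ ρ : Literature.NumberTheory.GaloisRepresentations.FramedArtinRep ℚ 2, ρ.toGaloisRep.IsIrreducible → ρ.IsOdd → ∃ (hcpt : Literature.NumberTheory.Automorphic.isCompact_glFiniteIntegralLevel 2 ℚ) (π : Literature.NumberTheory.Automorphic.CuspidalAutomorphicRepData 2 ℚ hcpt), Literature.NumberTheory.Automorphic.IsPiOfArtinRep ρ π.1) → Literature.NumberTheory.Automorphic.baseChange_cyclic_cuspidal → ∀ (K : Type) [Field K] [NumberField K], Module.finrank ℚ K = 2 → ∀ (p : ℕ) [Fact p.Prime] (ι : PadicAlgCl p ≃+* ℂ) (ρ : Literature.NumberTheory.GaloisRepresentations.FramedGaloisRep ℚ (PadicAlgCl p) 2), Finite ρ.toMonoidHom.range → ρ.IsOdd → (ρ.restrictField K).toGaloisRep.IsIrreducible → ∃ (hcpt : Literature.NumberTheory.Automorphic.isCompact_glFiniteIntegralLevel 2 K) (π : Literature.NumberTheory.Automorphic.CuspidalAutomorphicRepData 2 K hcpt), ∀ᶠ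 w : IsDedekindDomain.HeightOneSpectrum (NumberField.RingOfIntegers K) in Filter.cofinite, Summit.Langlands.SatakeFrobCompatibleAt ι π.1 (ρ.restrictField K) w := by
  intro hSA hBC K _ _ hK p _ ι ρ hfin hodd hirr
  set σ : FramedGaloisRep K (PadicAlgCl p) 2 := ρ.restrictField K with hσ
  have hfinσ : Finite σ.toMonoidHom.range := finite_range_restrictField K ρ hfin
  -- (1) contragredient transports of `ρ` (over `ℚ`) and of `σ = ρ|_K` (over `K`)
  obtain ⟨τ, hτ, -, -⟩ := exists_dual_transport_projectiveImage ι ρ hfin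
  obtain ⟨τK, hτK, hfinτK, ⟨eK⟩⟩ := exists_dual_transport_projectiveImage ι σ hfinσ
  have heq : τ.restrictField K = τK := by
    refine ContinuousMonoidHom.ext fun g => Units.ext ?_
    rw [FramedGaloisRep.restrictField_apply, hτ, hτK, hσ, FramedGaloisRep.restrictField_apply]
  -- (2) `τ` is odd and irreducible (its restriction to `Γ_K` is)
  have hoddτ : FramedGaloisRep.IsOdd τ := stub_isOddDualTransport ι ρ τ hτ hodd
  have hirrτK : (τ.restrictField K).toGaloisRep.IsIrreducible := by
    rw [heq]; exact isIrreducible_of_dual_transport σ hirr τK hfinτK eK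
  have hirrτ : τ.toGaloisRep.IsIrreducible := isIrreducible_of_isIrreducible_restrictField K τ hirrτK
  -- (3) `π_ℚ = π(τ)` over `ℚ`, and a non-twist witness at an inert place
  obtain ⟨hcptQ, πQ, hπQ⟩ := hSA τ hirrτ hoddτ
  have hne := stub_inertNonTwistWitness K hK τ hirrτK πQ hπQ
  -- (4) the cuspidal weak base-change lift `Π = BC_K(π_ℚ)` (Arthur–Clozel Thm. 4.2 (a))
  haveI : Algebra.IsQuadraticExtension ℚ K := ⟨hK⟩
  haveI : IsGalois ℚ K := inferInstance
  have hprime : (Module.finrank ℚ K).Prime := hK ▸ Nat.prime_two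
  have hcptK : isCompact_glFiniteIntegralLevel 2 K := isCompact_glFiniteIntegralLevel_holds 2 K
  obtain ⟨P, hlift⟩ := hBC 2 ℚ K hprime hcptQ πQ hne hcptK
  -- (5) `Π = π(τ|_K)` a.e., i.e. a.e. `SatakeFrobCompatibleAt ι Π σ`
  have hPpi : IsPiOfArtinRep (τ.restrictField K) P.1 := stub_bcAscent τ πQ P hπQ hlift
  rw [heq] at hPpi
  exact ⟨hcptK, P,
    hPpi.mono fun w hw => (satakeFrobCompatibleAt_iff_of_dual_transport ι σ τK hτK P.1 w).2 hw⟩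

/-- **The odd base-change sector at EVERY unramified place (displayed hypotheses).**  As
`eventually_satakeFrobCompatibleAt_restrictField_of_isOdd`, plus the σ-unramified shadow of Gelbart
1997 Prop. 4.1 (`hG`, written out): the a.e. compatibility is upgraded to every place where
`ρ|_{Γ_K}` is unramified by the landed rigidity
`satakeFrobCompatibleAt_of_eventually_of_isUnramifiedAt hG` — the conclusion shape of R′. [folklore] -/
theorem satakeFrobCompatibleAt_restrictField_of_isOdd : (∀ ρ : Literature.NumberTheory.GaloisRepresentations.FramedArtinRep ℚ 2, ρ.toGaloisRep.IsIrreducible → ρ.IsOdd → ∃ (hcpt : Literature.NumberTheory.Automorphic.isCompact_glFiniteIntegralLevel 2 ℚ) (π : Literature.NumberTheory.Automorphic.CuspidalAutomorphicRepData 2 ℚ hcpt), Literature.NumberTheory.Automorphic.IsPiOfArtinRep ρ π.1) → Literature.NumberTheory.Automorphic.baseChange_cyclic_cuspidal → (∀ {F : Type} [Field F] [NumberField F] (hcpt : Literature.NumberTheory.Automorphic.isCompact_glFiniteIntegralLevel 2 F) (σ : Literature.NumberTheory.GaloisRepresentations.FramedArtinRep F 2) (π : Literature.NumberTheory.Automorphic.CuspidalAutomorphicRepData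 2 F hcpt), Literature.NumberTheory.Automorphic.IsPiOfArtinRep σ π.1 → ∀ v : IsDedekindDomain.HeightOneSpectrum (NumberField.RingOfIntegers F), σ.IsUnramifiedAt v → Literature.NumberTheory.Automorphic.FrobSatakeCompatibleAt σ π.1 v) → ∀ (K : Type) [Field K] [NumberField K], Module.finrank ℚ K = 2 → ∀ (p : ℕ) [Fact p.Prime] (ι : PadicAlgCl p ≃+* ℂ) (ρ : Literature.NumberTheory.GaloisRepresentations.FramedGaloisRep ℚ (PadicAlgCl p) 2), Finite ρ.toMonoidHom.range → ρ.IsOdd → (ρ.restrictField K).toGaloisRep.IsIrreducible → ∃ (hcpt : Literature.NumberTheory.Automorphic.isCompact_glFiniteIntegralLevel 2 K) (π : Literature.NumberTheory.Automorphic.CuspidalAutomorphicRepData 2 K hcpt), ∀ w : IsDedekindDomain.HeightOneSpectrum (NumberField.RingOfIntegers K), (ρ.restrictField K).IsUnramifiedAt w → Summit.Langlands.SatakeFrobCompatibleAt ι π.1 (ρ.restrictField K) w := by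
  intro hSA hBC hG K _ _ hK p _ ι ρ hfin hodd hirr
  obtain ⟨hcpt, π, hae⟩ :=
    eventually_satakeFrobCompatibleAt_restrictField_of_isOdd hSA hBC K hK p ι ρ hfin hodd hirr
  exact ⟨hcpt, π, fun w hw => satakeFrobCompatibleAt_of_eventually_of_isUnramifiedAt hG K p ι
    (ρ.restrictField K) (finite_range_restrictField K ρ hfin) hcpt π hae w hw⟩

/-- **The odd base-change sector from the NAMED facts**: Khare–Wintenberger 2009 Thm. 10.1 (ii) in
its Artin-conjecture form (`khareWintenberger_artinConjecture_of_isOdd`), Booker 2003 Corollary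
(`booker_strongArtin_of_artinConjecture`) — together odd strong Artin over `ℚ`
(`strongArtin_ae_of_isOdd`) —, Arthur–Clozel Thm. 4.2 (a) (`baseChange_cyclic_cuspidal`) and the
twisted Hecke theory of `GL(2)` (`JacquetLanglands1970_twistedHeckeTheoryGL2`, which gives Gelbart's
Prop. 4.1 by `frobSatakeCompatibleAt_of_isPiOfArtinRep_of_isUnramifiedAt_of_JacquetLanglands1970_twistedHeckeTheoryGL2`).
[folklore] -/
theorem satakeFrobCompatibleAt_restrictField_of_isOdd_of_facts : Literature.NumberTheory.Automorphic.khareWintenberger_artinConjecture_of_isOdd → Literature.NumberTheory.Automorphic.booker_strongArtin_of_artinConjecture → Literature.NumberTheory.Automorphic.baseChange_cyclic_cuspidal → Literature.NumberTheory.Automorphic.JacquetLanglands1970_twistedHeckeTheoryGL2 → ∀ (K : Type) [Field K] [NumberField K], Module.finrank ℚ K = 2 → ∀ (p : ℕ) [Fact p.Prime] (ι : PadicAlgCl p ≃+* ℂ) (ρ : Literature.NumberTheory.GaloisRepresentations.FramedGaloisRep ℚ (PadicAlgCl p) 2), Finite ρ.toMonoidHom.range → ρ.IsOdd → (ρ.restrictField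 K).toGaloisRep.IsIrreducible → ∃ (hcpt : Literature.NumberTheory.Automorphic.isCompact_glFiniteIntegralLevel 2 K) (π : Literature.NumberTheory.Automorphic.CuspidalAutomorphicRepData 2 K hcpt), ∀ w : IsDedekindDomain.HeightOneSpectrum (NumberField.RingOfIntegers K), (ρ.restrictField K).IsUnramifiedAt w → Summit.Langlands.SatakeFrobCompatibleAt ι π.1 (ρ.restrictField K) w := by
  intro hKW hB hBC hJL K _ _ hK p _ ι ρ hfin hodd hirr
  have hG : frobSatakeCompatibleAt_of_isPiOfArtinRep_of_isUnramifiedAt :=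
    frobSatakeCompatibleAt_of_isPiOfArtinRep_of_isUnramifiedAt_of_JacquetLanglands1970_twistedHeckeTheoryGL2 hJL
  exact satakeFrobCompatibleAt_restrictField_of_isOdd
    (fun τ hirr hodd => strongArtin_ae_of_isOdd hKW hB τ hirr hodd) hBC
    (fun hcpt τ π hπ v hv => hG hcpt τ π hπ v hv) K hK p ι ρ hfin hodd hirr

/-- **R′ on the odd base-change sector** (registered stub `artinWeightRealisationLevel_oddBaseChange_sector`):
the crux `ParityBlindBianchi.ArtinWeightRealisationLevel` restricted to the `σ : Γ_K → GL₂(ℚ̄_p)`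
that are restrictions `ρ|_{Γ_K}` of an ODD finite-image `ρ : Γ_ℚ → GL₂(ℚ̄_p)` holds modulo the four
named facts (KW odd Artin, Booker, Arthur–Clozel 4.2 (a), JL): the `p`-adic automorphy hypothesis is
used only through `IsHeckeAssociatedAt.isUnramifiedAt` (σ is unramified at every good place).
[folklore] -/
theorem artinWeightRealisationLevel_oddBaseChange_sector : Literature.NumberTheory.Automorphic.khareWintenberger_artinConjecture_of_isOdd → Literature.NumberTheory.Automorphic.booker_strongArtin_of_artinConjecture → Literature.NumberTheory.Automorphic.baseChange_cyclic_cuspidal → Literature.NumberTheory.Automorphic.JacquetLanglands1970_twistedHeckeTheoryGL2 → ∀ (K : Type) [Field K] [NumberField K], NumberField.IsTotallyComplex K → Module.finrank ℚ K = 2 → ∀ (p : ℕ) [Fact p.Prime] (ι : PadicAlgCl p ≃+* ℂ) (σ : Literature.NumberTheory.GaloisRepresentations.FramedGaloisRep K (PadicAlgCl p) 2), Finite σ.toMonoidHom.range → σ.toGaloisRep.IsIrreducible → (∃ ρ : Literature.NumberTheory.GaloisRepresentations.FramedGaloisRep ℚ (PadicAlgCl p) 2, Finite ρ.toMonoidHom.range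 ∧ ρ.IsOdd ∧ ρ.restrictField K = σ) → ∀ S₀ : Finset ℕ, p ∈ S₀ → (∃ (U : Subgroup (GL (Fin 2) (IsDedekindDomain.FiniteAdeleRing (NumberField.RingOfIntegers K) K))) (ϖ : ∀ v : IsDedekindDomain.HeightOneSpectrum (NumberField.RingOfIntegers K), (v.adicCompletion K)ˣ) (a : {v : IsDedekindDomain.HeightOneSpectrum (NumberField.RingOfIntegers K) // ∀ ℓ ∈ S₀, ((ℓ : ℕ) : NumberField.RingOfIntegers K) ∉ v.asIdeal} → ℕ → (Valued.v (R := PadicAlgCl p)).valuationSubring), IsOpen (U : Set (GL (Fin 2) (IsDedekindDomain.FiniteAdeleRing (NumberField.RingOfIntegers K) K))) ∧ U ≤ Literature.NumberTheory.Automorphic.glFiniteIntegralLevel 2 K ∧ (∀ g ∈ Literature.NumberTheory.Automorphic.glFiniteIntegralLevel 2 K, (∀ v : IsDedekindDomain.HeightOneSpectrum (NumberField.RingOfIntegers K), ¬ (∀ ℓ ∈ S₀, ((ℓ : ℕ) : NumberField.RingOfIntegers K) ∉ v.asIdeal) → ∀ i j : Fin 2, ((g : Matrix (Fin 2) (Fin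 2) (IsDedekindDomain.FiniteAdeleRing (NumberField.RingOfIntegers K) K)) i j) v = (1 : Matrix (Fin 2) (Fin 2) (v.adicCompletion K)) i j) → g ∈ U) ∧ (∀ v : IsDedekindDomain.HeightOneSpectrum (NumberField.RingOfIntegers K), Valued.v ((ϖ v : (v.adicCompletion K)ˣ) : v.adicCompletion K) = WithZero.exp (-1 : ℤ)) ∧ Literature.NumberTheory.Automorphic.IsHeckePoint (Matrix.GeneralLinearGroup.map (n := Fin 2) (algebraMap K (IsDedekindDomain.FiniteAdeleRing (NumberField.RingOfIntegers K) K))) (Literature.NumberTheory.Automorphic.LevelTower.ofSeq U (fun r : ℕ => (Literature.NumberTheory.Automorphic.principalCongruenceLevel 2 K (Ideal.span {((p : ℕ) : NumberField.RingOfIntegers K)} ^ r)).map (Literature.NumberTheory.Automorphic.GLn.sndHom 2 K))) ((p : ℕ) : (Valued.v (R := PadicAlgCl p)).valuationSubring) (fun j : {v : IsDedekindDomain.HeightOneSpectrum (NumberField.RingOfIntegers K) // ∀ ℓ ∈ S₀, ((ℓ : ℕ) : NumberField.RingOfIntegers K) ∉ v.asIdeal} × Fin 2 => Literature.NumberTheory.Automorphic.GLn.sndHom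 2 K (Literature.NumberTheory.Automorphic.heckeDiagAt 2 K j.1.1 (ϖ j.1.1) (j.2.val + 1))) (fun j => a j.1 (j.2.val + 1)) ∧ ∀ (v : IsDedekindDomain.HeightOneSpectrum (NumberField.RingOfIntegers K)) (hv : ∀ ℓ ∈ S₀, ((ℓ : ℕ) : NumberField.RingOfIntegers K) ∉ v.asIdeal), σ.IsHeckeAssociatedAt v (fun i : ℕ => if i = 0 then (1 : PadicAlgCl p) else ((a ⟨v, hv⟩ i : (Valued.v (R := PadicAlgCl p)).valuationSubring) : PadicAlgCl p))) → ∃ (hcpt : Literature.NumberTheory.Automorphic.isCompact_glFiniteIntegralLevel 2 K) (π : Literature.NumberTheory.Automorphic.CuspidalAutomorphicRepData 2 K hcpt), ∀ w : IsDedekindDomain.HeightOneSpectrum (NumberField.RingOfIntegers K), (∀ ℓ ∈ S₀, ((ℓ : ℕ) : NumberField.RingOfIntegers K) ∉ w.asIdeal) → Summit.Langlands.SatakeFrobCompatibleAt ι π.1 σ w := by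
  intro hKW hB hBC hJL K _ _ _ hdeg p _ ι σ _ hirr hsec S₀ _ hyp
  obtain ⟨ρ, hfinρ, hodd, rfl⟩ := hsec
  obtain ⟨hcpt, π, hπ⟩ := satakeFrobCompatibleAt_restrictField_of_isOdd_of_facts hKW hB hBC hJL K hdeg p ι ρ
    hfinρ hodd hirr
  refine ⟨hcpt, π, fun w hw => hπ w ?_⟩
  obtain ⟨U, ϖ, a, -, -, -, -, -, hassoc⟩ := hyp
  exact (hassoc w hw).isUnramifiedAt

/-- **The open residue of R′ is the non-solvable, non-odd-base-change sector** (registered stub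
`artinWeightRealisationLevel_of_residual_sector`).  Modulo the five named facts — Langlands–Tunnell
(`strongArtin_of_isSolvable`), Khare–Wintenberger odd Artin, Booker, Arthur–Clozel 4.2 (a), JL — the
crux follows from its restriction to the `σ` with INSOLUBLE (icosahedral) projective image that are
NOT the restriction to `Γ_K` of an odd finite-image representation of `Γ_ℚ`: exactly the sector in
which the route `ParityBlindBianchi` consumes R′ (`σ = ρ|_{Γ_K}`, `ρ` EVEN icosahedral). [folklore] -/
theorem artinWeightRealisationLevel_of_residual_sector : Literature.NumberTheory.Automorphic.strongArtin_of_isSolvable → Literature.NumberTheory.Automorphic.khareWintenberger_artinConjecture_of_isOdd → Literature.NumberTheory.Automorphic.booker_strongArtin_of_artinConjecture → Literature.NumberTheory.Automorphic.baseChange_cyclic_cuspidal → Literature.NumberTheory.Automorphic.JacquetLanglands1970_twistedHeckeTheoryGL2 → (∀ (K : Type) [Field K] [NumberField K], NumberField.IsTotallyComplex K → Module.finrank ℚ K = 2 → ∀ (p : ℕ) [Fact p.Prime] (ι : PadicAlgCl p ≃+* ℂ) (σ : Literature.NumberTheory.GaloisRepresentations.FramedGaloisRep K (PadicAlgCl p)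 2), Finite σ.toMonoidHom.range → σ.toGaloisRep.IsIrreducible → ¬ IsSolvable (Literature.NumberTheory.GaloisRepresentations.projectiveImage σ.toMonoidHom) → ¬ (∃ ρ : Literature.NumberTheory.GaloisRepresentations.FramedGaloisRep ℚ (PadicAlgCl p) 2, Finite ρ.toMonoidHom.range ∧ ρ.IsOdd ∧ ρ.restrictField K = σ) → ∀ S₀ : Finset ℕ, p ∈ S₀ → (∃ (U : Subgroup (GL (Fin 2) (IsDedekindDomain.FiniteAdeleRing (NumberField.RingOfIntegers K) K))) (ϖ : ∀ v : IsDedekindDomain.HeightOneSpectrum (NumberField.RingOfIntegers K), (v.adicCompletion K)ˣ) (a : {v : IsDedekindDomain.HeightOneSpectrum (NumberField.RingOfIntegers K) // ∀ ℓ ∈ S₀, ((ℓ : ℕ) : NumberField.RingOfIntegers K) ∉ v.asIdeal} → ℕ → (Valued.v (R := PadicAlgCl p)).valuationSubring), IsOpen (U : Set (GL (Fin 2) (IsDedekindDomain.FiniteAdeleRing (NumberField.RingOfIntegers K) K))) ∧ U ≤ Literature.NumberTheory.Automorphic.glFiniteIntegralLevel 2 K ∧ (∀ g ∈ Literature.NumberTheory.Automorphic.glFiniteIntegralLevel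 2 K, (∀ v : IsDedekindDomain.HeightOneSpectrum (NumberField.RingOfIntegers K), ¬ (∀ ℓ ∈ S₀, ((ℓ : ℕ) : NumberField.RingOfIntegers K) ∉ v.asIdeal) → ∀ i j : Fin 2, ((g : Matrix (Fin 2) (Fin 2) (IsDedekindDomain.FiniteAdeleRing (NumberField.RingOfIntegers K) K)) i j) v = (1 : Matrix (Fin 2) (Fin 2) (v.adicCompletion K)) i j) → g ∈ U) ∧ (∀ v : IsDedekindDomain.HeightOneSpectrum (NumberField.RingOfIntegers K), Valued.v ((ϖ v : (v.adicCompletion K)ˣ) : v.adicCompletion K) = WithZero.exp (-1 : ℤ)) ∧ Literature.NumberTheory.Automorphic.IsHeckePoint (Matrix.GeneralLinearGroup.map (n := Fin 2) (algebraMap K (IsDedekindDomain.FiniteAdeleRing (NumberField.RingOfIntegers K) K))) (Literature.NumberTheory.Automorphic.LevelTower.ofSeq U (fun r : ℕ => (Literature.NumberTheory.Automorphic.principalCongruenceLevel 2 K (Ideal.span {((p : ℕ) : NumberField.RingOfIntegers K)} ^ r)).map (Literature.NumberTheory.Automorphic.GLn.sndHom 2 K))) ((p : ℕ) : (Valued.v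 (R := PadicAlgCl p)).valuationSubring) (fun j : {v : IsDedekindDomain.HeightOneSpectrum (NumberField.RingOfIntegers K) // ∀ ℓ ∈ S₀, ((ℓ : ℕ) : NumberField.RingOfIntegers K) ∉ v.asIdeal} × Fin 2 => Literature.NumberTheory.Automorphic.GLn.sndHom 2 K (Literature.NumberTheory.Automorphic.heckeDiagAt 2 K j.1.1 (ϖ j.1.1) (j.2.val + 1))) (fun j => a j.1 (j.2.val + 1)) ∧ ∀ (v : IsDedekindDomain.HeightOneSpectrum (NumberField.RingOfIntegers K)) (hv : ∀ ℓ ∈ S₀, ((ℓ : ℕ) : NumberField.RingOfIntegers K) ∉ v.asIdeal), σ.IsHeckeAssociatedAt v (fun i : ℕ => if i = 0 then (1 : PadicAlgCl p) else ((a ⟨v, hv⟩ i : (Valued.v (R := PadicAlgCl p)).valuationSubring) : PadicAlgCl p))) → ∃ (hcpt : Literature.NumberTheory.Automorphic.isCompact_glFiniteIntegralLevel 2 K) (π : Literature.NumberTheory.Automorphic.CuspidalAutomorphicRepData 2 K hcpt), ∀ w : IsDedekindDomain.HeightOneSpectrum (NumberField.RingOfIntegers K), (∀ ℓ ∈ S₀,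 ((ℓ : ℕ) : NumberField.RingOfIntegers K) ∉ w.asIdeal) → Summit.Langlands.SatakeFrobCompatibleAt ι π.1 σ w) → Summit.Langlands.Langlands.Theses.ParityBlindBianchi.ArtinWeightRealisationLevel := by
  intro hLT hKW hB hBC hJL h6 K _ _ htc hdeg p _ ι σ hfin hirr S₀ hp hyp
  have hG : frobSatakeCompatibleAt_of_isPiOfArtinRep_of_isUnramifiedAt :=
    frobSatakeCompatibleAt_of_isPiOfArtinRep_of_isUnramifiedAt_of_JacquetLanglands1970_twistedHeckeTheoryGL2 hJL
  by_cases hs : IsSolvable (projectiveImage σ.toMonoidHom)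
  · obtain ⟨hcpt, π, hπ⟩ :=
      satakeFrobCompatibleAt_of_isSolvable_projectiveImage hLT
        (fun hcpt σ π hπ v hv => hG hcpt σ π hπ v hv) K p ι σ hfin hirr hs
    refine ⟨hcpt, π, fun w hw => hπ w ?_⟩
    obtain ⟨U, ϖ, a, -, -, -, -, -, hassoc⟩ := hyp
    exact (hassoc w hw).isUnramifiedAt
  · exact (Classical.em _).elim
      (fun hsec => artinWeightRealisationLevel_oddBaseChange_sector hKW hB hBC hJL K ‹_› hdeg p ι σ hfin
        hirr hsec S₀ hp hyp)
      (fun hsec => h6 K htc hdeg p ι σ hfin hirr hs hsec S₀ hp hyp)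

/-- **The shared crux R on the odd base-change sector** (registered stub
`artinWeightRealisation_oddBaseChange_sector`): `RuelleTorsionArtinWeight.ArtinWeightRealisation`
(item stmt-Langlands-11057) restricted to the `σ = ρ|_{Γ_K}` with `ρ` ODD of finite image holds
modulo the THREE named facts KW odd Artin, Booker, Arthur–Clozel 4.2 (a) — no Hecke theory of
`GL(2)` (the conclusion of R is only a.e.); the `p`-adic automorphy hypothesis of R is not used at
all. [folklore] -/
theorem artinWeightRealisation_oddBaseChange_sector : Literature.NumberTheory.Automorphic.khareWintenberger_artinConjecture_of_isOdd → Literature.NumberTheory.Automorphic.booker_strongArtin_of_artinConjecture → Literature.NumberTheory.Automorphic.baseChange_cyclic_cuspidal → ∀ (K : Type) [Field K] [NumberField K], NumberField.IsTotallyComplex K → Module.finrank ℚ K = 2 → ∀ (p : ℕ) [Fact p.Prime] (ι : PadicAlgCl p ≃+* ℂ) (σ : Literature.NumberTheory.GaloisRepresentations.FramedGaloisRep K (PadicAlgCl p) 2), Finite σ.toMonoidHom.range → σ.toGaloisRep.IsIrreducible → (∃ ρ : Literature.NumberTheory.GaloisRepresentations.FramedGaloisRep ℚ (PadicAlgCl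 p) 2, Finite ρ.toMonoidHom.range ∧ ρ.IsOdd ∧ ρ.restrictField K = σ) → (∃ (S : Finset (IsDedekindDomain.HeightOneSpectrum (NumberField.RingOfIntegers K))) (U : Subgroup (GL (Fin 2) (IsDedekindDomain.FiniteAdeleRing (NumberField.RingOfIntegers K) K))) (ϖ : ∀ v : IsDedekindDomain.HeightOneSpectrum (NumberField.RingOfIntegers K), (v.adicCompletion K)ˣ) (a : {v : IsDedekindDomain.HeightOneSpectrum (NumberField.RingOfIntegers K) // v ∉ S} → ℕ → (Valued.v (R := PadicAlgCl p)).valuationSubring), (∀ v : IsDedekindDomain.HeightOneSpectrum (NumberField.RingOfIntegers K), ((p : ℕ) : NumberField.RingOfIntegers K) ∈ v.asIdeal → v ∈ S) ∧ IsOpen (U : Set (GL (Fin 2) (IsDedekindDomain.FiniteAdeleRing (NumberField.RingOfIntegers K) K))) ∧ U ≤ Literature.NumberTheory.Automorphic.glFiniteIntegralLevel 2 K ∧ (∀ g ∈ Literature.NumberTheory.Automorphic.glFiniteIntegralLevel 2 K, (∀ v ∈ S, ∀ i j : Fin 2, ((g : Matrix (Fin 2) (Fin 2) (IsDedekindDomain.FiniteAdeleRing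 (NumberField.RingOfIntegers K) K)) i j) v = (1 : Matrix (Fin 2) (Fin 2) (v.adicCompletion K)) i j) → g ∈ U) ∧ (∀ v : IsDedekindDomain.HeightOneSpectrum (NumberField.RingOfIntegers K), Valued.v ((ϖ v : (v.adicCompletion K)ˣ) : v.adicCompletion K) = WithZero.exp (-1 : ℤ)) ∧ Literature.NumberTheory.Automorphic.IsHeckePoint (Matrix.GeneralLinearGroup.map (n := Fin 2) (algebraMap K (IsDedekindDomain.FiniteAdeleRing (NumberField.RingOfIntegers K) K))) (Literature.NumberTheory.Automorphic.LevelTower.ofSeq U (fun r : ℕ => (Literature.NumberTheory.Automorphic.principalCongruenceLevel 2 K (Ideal.span {((p : ℕ) : NumberField.RingOfIntegers K)} ^ r)).map (Literature.NumberTheory.Automorphic.GLn.sndHom 2 K))) ((p : ℕ) : (Valued.v (R := PadicAlgCl p)).valuationSubring) (fun j : {v : IsDedekindDomain.HeightOneSpectrum (NumberField.RingOfIntegers K) // v ∉ S} × Fin 2 => Literature.NumberTheory.Automorphic.GLn.sndHom 2 K (Literature.NumberTheory.Automorphic.heckeDiagAt 2 K j.1.1 (ϖ j.1.1) (j.2.val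 + 1))) (fun j => a j.1 (j.2.val + 1)) ∧ ∀ (v : IsDedekindDomain.HeightOneSpectrum (NumberField.RingOfIntegers K)) (hv : v ∉ S), σ.IsHeckeAssociatedAt v (fun i : ℕ => if i = 0 then (1 : PadicAlgCl p) else ((a ⟨v, hv⟩ i : (Valued.v (R := PadicAlgCl p)).valuationSubring) : PadicAlgCl p))) → ∃ (hcpt : Literature.NumberTheory.Automorphic.isCompact_glFiniteIntegralLevel 2 K) (π : Literature.NumberTheory.Automorphic.CuspidalAutomorphicRepData 2 K hcpt), ∀ᶠ w : IsDedekindDomain.HeightOneSpectrum (NumberField.RingOfIntegers K) in Filter.cofinite, Summit.Langlands.SatakeFrobCompatibleAt ι π.1 σ w := by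
  intro hKW hB hBC K _ _ _ hdeg p _ ι σ _ _ hsec _
  obtain ⟨ρ, hfinρ, hodd, rfl⟩ := hsec
  exact eventually_satakeFrobCompatibleAt_restrictField_of_isOdd
    (fun τ hirr hodd => strongArtin_ae_of_isOdd hKW hB τ hirr hodd) hBC K hdeg p ι ρ hfinρ hodd ‹_›

/-- **The open residue of the shared crux R** (registered stub `artinWeightRealisation_of_residual_sector`):
modulo Langlands–Tunnell, KW odd Artin, Booker and Arthur–Clozel 4.2 (a) — four named facts, no
Hecke theory — `RuelleTorsionArtinWeight.ArtinWeightRealisation` follows from its restriction to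
the `σ` with insoluble projective image that are not the restriction to `Γ_K` of an odd finite-image
representation of `Γ_ℚ` (solvable sector: `eventually_satakeFrobCompatibleAt_of_isSolvable_projectiveImage`
is the tree's `…InsolubleCore`; here it is re-derived pointwise from `…SolvableSector`'s transport API
to keep the import closure small). [folklore] -/
theorem artinWeightRealisation_of_residual_sector : Literature.NumberTheory.Automorphic.strongArtin_of_isSolvable → Literature.NumberTheory.Automorphic.khareWintenberger_artinConjecture_of_isOdd → Literature.NumberTheory.Automorphic.booker_strongArtin_of_artinConjecture → Literature.NumberTheory.Automorphic.baseChange_cyclic_cuspidal → (∀ (K : Type) [Field K] [NumberField K], NumberField.IsTotallyComplex K → Module.finrank ℚ K = 2 → ∀ (p : ℕ) [Fact p.Prime] (ι : PadicAlgCl p ≃+* ℂ) (σ : Literature.NumberTheory.GaloisRepresentations.FramedGaloisRep K (PadicAlgCl p) 2), Finite σ.toMonoidHom.range → σ.toGaloisRep.IsIrreducible → ¬ IsSolvable (Literature.NumberTheory.GaloisRepresentations.projectiveImage σ.toMonoidHom) → ¬ (∃ ρ : Literature.NumberTheory.GaloisRepresentations.FramedGaloisRep ℚ (PadicAlgCl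 p) 2, Finite ρ.toMonoidHom.range ∧ ρ.IsOdd ∧ ρ.restrictField K = σ) → (∃ (S : Finset (IsDedekindDomain.HeightOneSpectrum (NumberField.RingOfIntegers K))) (U : Subgroup (GL (Fin 2) (IsDedekindDomain.FiniteAdeleRing (NumberField.RingOfIntegers K) K))) (ϖ : ∀ v : IsDedekindDomain.HeightOneSpectrum (NumberField.RingOfIntegers K), (v.adicCompletion K)ˣ) (a : {v : IsDedekindDomain.HeightOneSpectrum (NumberField.RingOfIntegers K) // v ∉ S} → ℕ → (Valued.v (R := PadicAlgCl p)).valuationSubring), (∀ v : IsDedekindDomain.HeightOneSpectrum (NumberField.RingOfIntegers K), ((p : ℕ) : NumberField.RingOfIntegers K) ∈ v.asIdeal → v ∈ S) ∧ IsOpen (U : Set (GL (Fin 2) (IsDedekindDomain.FiniteAdeleRing (NumberField.RingOfIntegers K) K))) ∧ U ≤ Literature.NumberTheory.Automorphic.glFiniteIntegralLevel 2 K ∧ (∀ g ∈ Literature.NumberTheory.Automorphic.glFiniteIntegralLevel 2 K, (∀ v ∈ S, ∀ i j : Fin 2, ((g : Matrix (Fin 2) (Fin 2) (IsDedekindDomain.FiniteAdeleRing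 (NumberField.RingOfIntegers K) K)) i j) v = (1 : Matrix (Fin 2) (Fin 2) (v.adicCompletion K)) i j) → g ∈ U) ∧ (∀ v : IsDedekindDomain.HeightOneSpectrum (NumberField.RingOfIntegers K), Valued.v ((ϖ v : (v.adicCompletion K)ˣ) : v.adicCompletion K) = WithZero.exp (-1 : ℤ)) ∧ Literature.NumberTheory.Automorphic.IsHeckePoint (Matrix.GeneralLinearGroup.map (n := Fin 2) (algebraMap K (IsDedekindDomain.FiniteAdeleRing (NumberField.RingOfIntegers K) K))) (Literature.NumberTheory.Automorphic.LevelTower.ofSeq U (fun r : ℕ => (Literature.NumberTheory.Automorphic.principalCongruenceLevel 2 K (Ideal.span {((p : ℕ) : NumberField.RingOfIntegers K)} ^ r)).map (Literature.NumberTheory.Automorphic.GLn.sndHom 2 K))) ((p : ℕ) : (Valued.v (R := PadicAlgCl p)).valuationSubring) (fun j : {v : IsDedekindDomain.HeightOneSpectrum (NumberField.RingOfIntegers K) // v ∉ S} × Fin 2 => Literature.NumberTheory.Automorphic.GLn.sndHom 2 K (Literature.NumberTheory.Automorphic.heckeDiagAt 2 K j.1.1 (ϖ j.1.1) (j.2.val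 + 1))) (fun j => a j.1 (j.2.val + 1)) ∧ ∀ (v : IsDedekindDomain.HeightOneSpectrum (NumberField.RingOfIntegers K)) (hv : v ∉ S), σ.IsHeckeAssociatedAt v (fun i : ℕ => if i = 0 then (1 : PadicAlgCl p) else ((a ⟨v, hv⟩ i : (Valued.v (R := PadicAlgCl p)).valuationSubring) : PadicAlgCl p))) → ∃ (hcpt : Literature.NumberTheory.Automorphic.isCompact_glFiniteIntegralLevel 2 K) (π : Literature.NumberTheory.Automorphic.CuspidalAutomorphicRepData 2 K hcpt), ∀ᶠ w : IsDedekindDomain.HeightOneSpectrum (NumberField.RingOfIntegers K) in Filter.cofinite, Summit.Langlands.SatakeFrobCompatibleAt ι π.1 σ w) → Summit.Langlands.Langlands.Theses.RuelleTorsionArtinWeight.ArtinWeightRealisation := by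
  intro hLT hKW hB hBC h5 K _ _ htc hdeg p _ ι σ hfin hirr hyp
  by_cases hs : IsSolvable (projectiveImage σ.toMonoidHom)
  · obtain ⟨τ, hτ, hfinτ, ⟨e⟩⟩ := exists_dual_transport_projectiveImage ι σ hfin
    have hirrτ : τ.toGaloisRep.IsIrreducible := isIrreducible_of_dual_transport σ hirr τ hfinτ e
    have hsolvτ : IsSolvable (projectiveImage τ.toMonoidHom) :=
      isSolvable_projectiveImage_of_dual_transport σ hs τ e
    obtain ⟨hcpt, π, hpi⟩ := hLT τ hirrτ hsolvτ
    exact ⟨hcpt, π,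
      hpi.mono fun w hw => (satakeFrobCompatibleAt_iff_of_dual_transport ι σ τ hτ π.1 w).2 hw⟩
  · exact (Classical.em _).elim
      (fun hsec => artinWeightRealisation_oddBaseChange_sector hKW hB hBC K ‹_› hdeg p ι σ hfin hirr
        hsec hyp)
      (fun hsec => h5 K htc hdeg p ι σ hfin hirr hs hsec hyp)

end Summit.Langlands.Langlands.Theorems.ArtinWeightRealisationLevel

end
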